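import Literature.NumberTheory.LFunctions.Zhang2022.KnifeEdgeEllThinBDHZhang

/-!
# §D edge ell — the class-0 lower bound for the ADDITIVE thin variance (F-ref1-ℓ1, kernel half): Parseval on `ℤ/m`
# at a prime modulus, `Σ*_{a mod m}|S(a/m)|² = m·Σ_b |C_b − T/m|² ≥ m·|C₀ − T/m|²`, and the refutation schema it feeds

Y. Zhang, *Discrete mean estimates and the Landau–Siegel zero*, arXiv:2211.02515v1 [Zhang2022LandauSiegel] — an
unrefereed manuscript under adjudication. **WHAT THIS IS NOT: not a claim about Theorems 1–2 of arXiv:2211.02515, about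
Landau–Siegel zeros, about Parity, or about a repaired `Margin232`; NOT a refutation of any typed hypothesis: nothing below
asserts anything about Zhang's coefficient family `κ* = κ₁∗b`. The theorems are finite Fourier analysis on `ℤ/m` plus
bookkeeping against the tree objects `lSumAdd` / `thinVarianceAdd` / `ThinBDHAt` (p489286) and `ThinBDHZhangAt` (p493151);
the one new `Prop`, `ClassZeroBeats`, is the ANALYTIC half of the refuter's falsifier, asserted by no one. The programme
SEARCHES and TYPES; no claim about Landau–Siegel zeros, Theorems 1–2 of arXiv:2211.02515 or a repaired Margin232 until a
kernel theorem says so.** (LANDAU–SIEGEL programme F-S3, cell `landau-siegel`, §D edge ell = E*-ℓ⁺ / §E row E-ell-3;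
negative lane of the card `prime-discharge-thin-bdh` (ls-knife-ell-idea-1 g2; CLOSED reduces-to/variant); Parts A–B adapted
from the refuter's PROVED scratch `HOME/ls-ref-1/lean/ClassZeroThinBDH.lean` sha16 e552a57bc10e8da7 (ls-ref-1 g3,
2026-08-27T04:17:52Z, «→typer HANDOFF»; falsifier F-ref1-ℓ1 of `HOME/ls-ref-1/VERDICTS.md` §29); typer ls-knife-typer-2 g5.)

## Why this exists (words of record)

Per the custodian's census (ls-theory g3, ELL-CENSUS (μ), 2026-08-27T04:12:58Z) the card's ADDITIVE objects `thinVarianceAdd` /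
`ThinBDHAt` / `ThinBDH` / `ThinBDHZhangAt` / `ThinBDHZhang` are «REFUTATION TARGETS ONLY»; the hypothesis / bridge OF RECORD is the
multiplicative large-conductor form `ThinBDHAllAt` / `ThinBDHBridgeAll` (p494419). The refuter's observation: `lSumAdd` sums over
ALL `ℓ` with NO main term removed, so for a PRIME modulus `m` the reduced-residue variance `Σ_{0<a<m}|S(a/m)|²` equals
`m·Σ_{b mod m}|C_b − T/m|²` EXACTLY and dominates the class-0 term `m·|C₀ − T/m|²` — non-unit-frequency mass no hypothesis on
the units removes. This file lands that KERNEL half; the ANALYTIC half (for `κ* = κ₁∗b`, `d = 1`, `τ = 0`, principal twist: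
`|T| ≳ N/𝓛^{O(1)}`, `|C₀(m) − T/m| ≍ |T|/m` on `≫ M/log M` primes; VERDICTS §29 (i)–(iii)) is desk-level and NOT typed beyond
the bare `Prop` `ClassZeroBeats`.

## What is here

* Part A (pure Mathlib; Montgomery–Vaughan MNT I §4.1 (4.1)/(4.4)) — `eAdd m a ℓ = e(aℓ/m)` (the exponential factor of `lSumAdd`, verbatim) and the root of
  unity `eRoot m = e(1/m)`; orthogonality `sum_range_eRoot_pow_mul` (`Σ_{a<m} ζ^{ka} = m·[m ∣ k]`); the pair kernel
  `sum_range_eAdd_mul_conj_eAdd`; **Parseval on `ℤ/m`, all frequencies** `parseval_range_eAdd`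
  (`Σ_{a<m}|Σ_ℓ c_ℓ e(aℓ/m)|² = m·Σ_{b<m}|C_b|²`, complex `z·conj z` form, any finite `ℓ`-set `L ⊂ ℕ`); at a PRIME modulus
  the reduced residues are `a ≠ 0`, whence **`reducedVariance_prime_eq`** (`Σ_{a<m,(a,m)=1}‖S(a/m)‖² = m·Σ_{b<m}‖C_b − T/m‖²`,
  EXACT) and **`reducedVariance_prime_ge_classZero`** (`≥ m·‖C₀ − T/m‖²`).
* Part B (bridge to the tree objects of p489286) — `lCoef κ d θ_D τ ℓ = κ(dℓ)θ_D(ℓ)ℓ^{iτ}`, `lWindow N = (⌊N⌋, ⌊2N⌋]`,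
  `lSumAdd_eq_sum_lCoef_mul_eAdd` (`rfl`); the class-0 sum `classZeroAdd κ d D θ_D τ N M :=
  Σ_{m ∈ (M,2M], (m,D)=1, m prime} m·‖C₀(m) − T/m‖²`; **`classZero_le_thinVarianceAdd`**:
  `classZeroAdd κ d D θ_D τ N M ≤ thinVarianceAdd κ d D {θ_D} τ N M` (the refuter's `classZero_le_thinVarianceAdd`, same
  statement with the left side named); monotonicity in the twist set `thinVarianceAdd_mono_twists`.
* Part C (refutation schema; bookkeeping, asserts nothing) — `ClassZeroBeats A B c κ` := the analytic half as a `Prop`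
  (for every allowance `(C, C′, D₀)` some admissible `(D, θ_D, d, τ, M)` has class-0 sum `>` the `ThinBDHAt` right side
  `C·N²·(M₀/M)·(log D)^{C′}`); **`not_thinBDHAt_of_classZeroBeats`**, `not_thinBDH_of_classZeroBeats`,
  `not_thinBDHZhangAt_of_classZeroBeats`, `not_thinBDHZhang_of_classZeroBeats` (so `¬ThinBDHAt A B c κ*` is EXACTLY the
  analytic half at `κ*`). The multiplicative objects of record (`thinVarianceLC`, `ThinBDHAllAt`) are untouched: there
  `(ℓ, D·m) = 1` and class 0 carries no weight (VERDICTS §29 «the witness MISSES C′»).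

Deliberately NOT here: the analytic half for `κ*` (XL in Lean; not pursued); any statement about `ThinBDHAllAt` /
`ThinBDHBridgeAll`; Gallagher's passage to primitive characters (tree: `Literature.NumberTheory.Sieve.LargeSieve.
mul_sum_primitive_norm_sq_le`). References: Zhang, arXiv:2211.02515v1, §14 (14.6)–(14.8) p.79; Montgomery–Vaughan,
*Multiplicative Number Theory I* (CUP 2007) [MontgomeryVaughan2007], §4.1: (4.1) p.108 (orthogonality of the additive
characters), (4.4) p.109 (Parseval on `ℤ/q`). [cite: Zhang2022LandauSiegel, §14 (14.8) p.79]
-/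

noncomputable section

open Finset
open scoped BigOperators ComplexConjugate

namespace Literature.NumberTheory.LFunctions.Zhang2022

namespace KnifeEdgeEll.PrimeDischarge

open KnifeEdge EllScales

/-! ## Part A — Parseval on `ℤ/m` and the reduced-residue variance at a prime modulus (pure Mathlib) -/

/-- `e(aℓ/m) = exp(2πi·aℓ/m)` — EXACTLY the exponential factor of `lSumAdd` (p489286), as a named function of
`(m, a, ℓ)` (junk value at `m = 0`: Lean's `x/0 = 0` gives `e(0) = 1`; never used there). [folklore] -/
def eAdd (m a l : ℕ) : ℂ :=
  Complex.exp (2 * Real.pi * Complex.I * ((a : ℂ) * (l : ℂ) / (m : ℂ)))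

/-- The primitive `m`-th root of unity `ζ_m = e(1/m) = exp(2πi/m)`. [folklore] -/
def eRoot (m : ℕ) : ℂ := Complex.exp (2 * Real.pi * Complex.I / m)

/-- `e(aℓ/m) = ζ_m^{aℓ}`. [folklore] -/
private theorem eAdd_eq_eRoot_pow (m a l : ℕ) (hm : m ≠ 0) : eAdd m a l = eRoot m ^ (a * l) := by
  unfold eAdd eRoot
  rw [← Complex.exp_nat_mul]
  congr 1; push_cast; field_simp

/-- `conj (ζ_m^n) = ζ_m^{(m−1)n}` (`conj ζ = ζ⁻¹ = ζ^{m−1}`; `ζ_m` is a primitive `m`-th root of unity, Mathlib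
`Complex.isPrimitiveRoot_exp`). [folklore] -/
private theorem conj_eRoot_pow {m : ℕ} (hm : m ≠ 0) (n : ℕ) : conj (eRoot m ^ n) = eRoot m ^ ((m - 1) * n) := by
  have hprim : IsPrimitiveRoot (eRoot m) m := Complex.isPrimitiveRoot_exp m hm
  have h1 : conj (eRoot m) = (eRoot m)⁻¹ := (Complex.inv_eq_conj (hprim.norm'_eq_one hm)).symm
  have h2 : (eRoot m)⁻¹ = eRoot m ^ (m - 1) := by
    refine (eq_inv_of_mul_eq_one_left ?_).symm
    rw [← pow_succ, Nat.sub_add_cancel (Nat.one_le_iff_ne_zero.mpr hm), hprim.pow_eq_one]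
  rw [map_pow, h1, h2, ← pow_mul]

/-- **Orthogonality of the additive characters of `ℤ/m`:** `Σ_{a<m} ζ_m^{ka} = m` if `m ∣ k`, else `0`
(Montgomery–Vaughan MNT I (4.1)). [cite: MontgomeryVaughan2007, §4.1 (4.1) p.108] -/
theorem sum_range_eRoot_pow_mul {m : ℕ} (hm : m ≠ 0) (k : ℕ) :
    ∑ a ∈ range m, eRoot m ^ (k * a) = if m ∣ k then (m : ℂ) else 0 := by
  have hprim : IsPrimitiveRoot (eRoot m) m := Complex.isPrimitiveRoot_exp m hm
  simp_rw [pow_mul]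
  split_ifs with hk
  · have : eRoot m ^ k = 1 := (hprim.pow_eq_one_iff_dvd k).mpr hk
    simp [this]
  · have hne : eRoot m ^ k ≠ 1 := fun h => hk ((hprim.pow_eq_one_iff_dvd k).mp h)
    rw [geom_sum_eq hne]
    have : (eRoot m ^ k) ^ m = 1 := by rw [← pow_mul, mul_comm, pow_mul, hprim.pow_eq_one, one_pow]
    rw [this]; simp

/-- `m ∣ ℓ + (m−1)ℓ′ ↔ ℓ ≡ ℓ′ (mod m)` (`m ≠ 0`). [folklore] -/
private theorem dvd_add_pred_mul_iff_mod_eq {m : ℕ} (hm : m ≠ 0) (l l' : ℕ) :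
    m ∣ l + (m - 1) * l' ↔ l % m = l' % m := by
  have key : l + (m - 1) * l' + l' = l + m * l' := by
    have : m - 1 + 1 = m := Nat.succ_pred_eq_of_ne_zero hm
    nlinarith [this]
  constructor
  · intro h
    have h2 : m ∣ (l + m * l') - l' := by
      rw [← key, Nat.add_sub_cancel]; exact h
    have := (Nat.modEq_iff_dvd' (by nlinarith [key] : l' ≤ l + m * l')).mpr h2
    have h3 : (l + m * l') % m = l % m := by simp
    unfold Nat.ModEq at this
    omega
  · intro h
    have : l' ≡ l + m * l' [MOD m] := by
      unfold Nat.ModEq; simp [h]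
    have h2 := (Nat.modEq_iff_dvd' (by nlinarith [key] : l' ≤ l + m * l')).mp this
    rw [← key, Nat.add_sub_cancel] at h2
    exact h2

/-- `e(aℓ/m)·conj e(aℓ′/m) = ζ_m^{(ℓ + (m−1)ℓ′)a}`. [folklore] -/
private theorem eAdd_mul_conj_eAdd {m : ℕ} (hm : m ≠ 0) (a l l' : ℕ) :
    eAdd m a l * conj (eAdd m a l') = eRoot m ^ ((l + (m - 1) * l') * a) := by
  rw [eAdd_eq_eRoot_pow m a l hm, eAdd_eq_eRoot_pow m a l' hm, conj_eRoot_pow hm, ← pow_add]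
  congr 1; ring

/-- **The pair kernel after the `a`-sum:** `Σ_{a<m} e(aℓ/m)·conj e(aℓ′/m) = m·[ℓ ≡ ℓ′ (mod m)]` (Montgomery–Vaughan MNT I
(4.1), the orthogonality relation of the additive characters). [cite: MontgomeryVaughan2007, §4.1 (4.1) p.108] -/
theorem sum_range_eAdd_mul_conj_eAdd {m : ℕ} (hm : m ≠ 0) (l l' : ℕ) :
    ∑ a ∈ range m, eAdd m a l * conj (eAdd m a l') = if l % m = l' % m then (m : ℂ) else 0 := by
  simp_rw [eAdd_mul_conj_eAdd hm, sum_range_eRoot_pow_mul hm, dvd_add_pred_mul_iff_mod_eq hm]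

/-- **Parseval on `ℤ/m` (all frequencies):** for `m ≠ 0`, any finite `L ⊂ ℕ` and complex `c_ℓ`,
`Σ_{a<m} |Σ_{ℓ∈L} c_ℓ e(aℓ/m)|² = m·Σ_{b<m} |Σ_{ℓ∈L, ℓ≡b (m)} c_ℓ|²`, as a complex identity `z·conj z`
— Montgomery–Vaughan MNT I (4.4) `Σ_{n mod q}|f(n)|² = q·Σ_k|f̂(k)|²` for the `q`-periodic function `b ↦ C_b`.
[cite: MontgomeryVaughan2007, §4.1 (4.4) p.109] -/
theorem parseval_range_eAdd {m : ℕ} (hm : m ≠ 0) (L : Finset ℕ) (c : ℕ → ℂ) :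
    ∑ a ∈ range m, (∑ l ∈ L, c l * eAdd m a l) * conj (∑ l ∈ L, c l * eAdd m a l)
      = (m : ℂ) * ∑ b ∈ range m,
          (∑ l ∈ L with l % m = b, c l) * conj (∑ l ∈ L with l % m = b, c l) := by
  have lhs : ∑ a ∈ range m, (∑ l ∈ L, c l * eAdd m a l) * conj (∑ l ∈ L, c l * eAdd m a l)
      = ∑ l ∈ L, ∑ l' ∈ L, c l * conj (c l') * (if l % m = l' % m then (m : ℂ) else 0) := by
    have step : ∀ a : ℕ, (∑ l ∈ L, c l * eAdd m a l) * conj (∑ l ∈ L, c l * eAdd m a l)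
        = ∑ l ∈ L, ∑ l' ∈ L, c l * conj (c l') * (eAdd m a l * conj (eAdd m a l')) := by
      intro a
      rw [map_sum, Finset.sum_mul_sum]
      refine Finset.sum_congr rfl fun l _ => Finset.sum_congr rfl fun l' _ => ?_
      rw [map_mul]; ring
    simp_rw [step]
    rw [Finset.sum_comm]
    refine Finset.sum_congr rfl fun l _ => ?_
    rw [Finset.sum_comm]
    refine Finset.sum_congr rfl fun l' _ => ?_
    rw [← Finset.mul_sum, sum_range_eAdd_mul_conj_eAdd hm]
  have rhs : ∑ b ∈ range m, (∑ l ∈ L with l % m = b, c l) * conj (∑ l ∈ L with l % m = b, c l)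
      = ∑ l ∈ L, ∑ l' ∈ L, c l * conj (c l') * (if l % m = l' % m then (1 : ℂ) else 0) := by
    have step : ∀ b : ℕ, (∑ l ∈ L with l % m = b, c l) * conj (∑ l ∈ L with l % m = b, c l)
        = ∑ l ∈ L, ∑ l' ∈ L, (if l % m = b ∧ l' % m = b then c l * conj (c l') else 0) := by
      intro b
      rw [map_sum, Finset.sum_filter, Finset.sum_filter, Finset.sum_mul_sum]
      refine Finset.sum_congr rfl fun l _ => Finset.sum_congr rfl fun l' _ => ?_
      by_cases h1 : l % m = b <;> by_cases h2 : l' % m = b <;> simp [h1, h2]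
    simp_rw [step]
    rw [Finset.sum_comm]
    refine Finset.sum_congr rfl fun l _ => ?_
    rw [Finset.sum_comm]
    refine Finset.sum_congr rfl fun l' _ => ?_
    have hl : l % m ∈ range m := Finset.mem_range.mpr (Nat.mod_lt l (Nat.pos_of_ne_zero hm))
    by_cases h : l % m = l' % m
    · rw [if_pos h, mul_one]
      rw [Finset.sum_eq_single (l % m)]
      · simp [h]
      · intro b _ hb; rw [if_neg]; rintro ⟨h1, _⟩; exact hb h1.symm
      · intro hnot; exact absurd hl hnot
    · rw [if_neg h, mul_zero]
      refine Finset.sum_eq_zero fun b _ => ?_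
      rw [if_neg]; rintro ⟨h1, h2⟩; exact h (h1.trans h2.symm)
  rw [lhs, rhs, Finset.mul_sum]
  refine Finset.sum_congr rfl fun l _ => ?_
  rw [Finset.mul_sum]
  refine Finset.sum_congr rfl fun l' _ => ?_
  by_cases h : l % m = l' % m <;> simp [h]; ring

/-- At a PRIME modulus the reduced residues in `[0, m)` are exactly the `a ≠ 0`. [folklore] -/
private theorem coprime_iff_ne_zero_of_prime {m a : ℕ} (hp : m.Prime) (ha : a < m) : Nat.Coprime a m ↔ a ≠ 0 := by
  rw [Nat.coprime_comm, hp.coprime_iff_not_dvd]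
  exact ⟨fun h h0 => h (h0 ▸ dvd_zero m), fun h hd => h (Nat.eq_zero_of_dvd_of_lt hd ha)⟩

/-- `e(0·ℓ/m) = 1`. [folklore] -/
private theorem eAdd_zero_left (m l : ℕ) : eAdd m 0 l = 1 := by simp [eAdd]

/-- The residue classes partition the `ℓ`-sum: `Σ_{b<m} C_b = T` (`m ≠ 0`). [folklore] -/
private theorem sum_range_fiber_mod_eq {m : ℕ} (hm : m ≠ 0) (L : Finset ℕ) (c : ℕ → ℂ) :
    ∑ b ∈ range m, ∑ l ∈ L with l % m = b, c l = ∑ l ∈ L, c l :=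
  Finset.sum_fiberwise_of_maps_to (fun l _ => Finset.mem_range.mpr (Nat.mod_lt l (Nat.pos_of_ne_zero hm))) c

/-- **Reduced-residue variance at a prime modulus, EXACT (complex form):** for `m` prime,
`Σ_{0<a<m} S(a/m)·conj S(a/m) = m·Σ_{b<m} (C_b − T/m)·conj(C_b − T/m)` with `S(a/m) = Σ_ℓ c_ℓ e(aℓ/m)`,
`C_b = Σ_{ℓ≡b (m)} c_ℓ`, `T = Σ_ℓ c_ℓ` — Parseval (Montgomery–Vaughan MNT I (4.4)) minus the `a = 0` term `T·conj T`, the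
reduced residues mod a prime being `a ≠ 0`. [cite: MontgomeryVaughan2007, §4.1 (4.4) p.109] -/
theorem reducedVariance_prime_mul_conj {m : ℕ} (hp : m.Prime) (L : Finset ℕ) (c : ℕ → ℂ) :
    ∑ a ∈ range m with Nat.Coprime a m,
        (∑ l ∈ L, c l * eAdd m a l) * conj (∑ l ∈ L, c l * eAdd m a l)
      = (m : ℂ) * ∑ b ∈ range m,
          ((∑ l ∈ L with l % m = b, c l) - (∑ l ∈ L, c l) / m) *
            conj ((∑ l ∈ L with l % m = b, c l) - (∑ l ∈ L, c l) / m) := by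
  have hm : m ≠ 0 := hp.ne_zero
  have hmC : (m : ℂ) ≠ 0 := Nat.cast_ne_zero.mpr hm
  set T := ∑ l ∈ L, c l with hT
  set C : ℕ → ℂ := fun b => ∑ l ∈ L with l % m = b, c l with hC
  set S : ℕ → ℂ := fun a => ∑ l ∈ L, c l * eAdd m a l with hS
  have h0 : S 0 = T := by simp [hS, hT, eAdd_zero_left]
  have hsplit : ∑ a ∈ range m with Nat.Coprime a m, S a * conj (S a)
      = ∑ a ∈ range m, S a * conj (S a) - T * conj T := by
    rw [← h0, eq_sub_iff_add_eq]
    have hmem : (0 : ℕ) ∈ range m := Finset.mem_range.mpr hp.pos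
    rw [← Finset.sum_erase_add _ _ hmem]
    congr 1
    refine Finset.sum_congr ?_ fun _ _ => rfl
    ext a
    simp only [Finset.mem_filter, Finset.mem_erase, Finset.mem_range]
    constructor
    · rintro ⟨ha, hc⟩; exact ⟨(coprime_iff_ne_zero_of_prime hp ha).mp hc, ha⟩
    · rintro ⟨hne, ha⟩; exact ⟨ha, (coprime_iff_ne_zero_of_prime hp ha).mpr hne⟩
  have hpar : ∑ a ∈ range m, S a * conj (S a) = (m : ℂ) * ∑ b ∈ range m, C b * conj (C b) :=
    parseval_range_eAdd hm L c
  have hsumC : ∑ b ∈ range m, C b = T := sum_range_fiber_mod_eq hm L c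
  have hsumCconj : ∑ b ∈ range m, conj (C b) = conj T := by rw [← map_sum, hsumC]
  have hrhs : (m : ℂ) * ∑ b ∈ range m, (C b - T / m) * conj (C b - T / m)
      = (m : ℂ) * ∑ b ∈ range m, C b * conj (C b) - T * conj T := by
    have e : ∀ b, (m : ℂ) * ((C b - T / m) * conj (C b - T / m))
        = (m : ℂ) * (C b * conj (C b)) - (C b * conj T + T * conj (C b)) + T * conj T / m := by
      intro b
      rw [map_sub, map_div₀, map_natCast]; field_simp; ring
    rw [Finset.mul_sum, Finset.mul_sum]
    simp_rw [e]
    have h1 : ∑ b ∈ range m, (C b * conj T + T * conj (C b)) = T * conj T + T * conj T := by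
      rw [Finset.sum_add_distrib, ← Finset.sum_mul, ← Finset.mul_sum, hsumC, hsumCconj]
    have h2 : ∑ b ∈ range m, T * conj T / (m : ℂ) = T * conj T := by
      rw [Finset.sum_const, Finset.card_range, nsmul_eq_mul]; field_simp
    rw [Finset.sum_add_distrib, Finset.sum_sub_distrib, h1, h2]
    ring
  change ∑ a ∈ range m with Nat.Coprime a m, S a * conj (S a)
    = (m : ℂ) * ∑ b ∈ range m, (C b - T / m) * conj (C b - T / m)
  rw [hsplit, hpar, hrhs]

/-- **Reduced-residue variance at a prime modulus, EXACT (F-ref1-ℓ1):** for `m` prime and any finitely supported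
coefficients, `Σ_{a<m,(a,m)=1} ‖Σ_ℓ c_ℓ e(aℓ/m)‖² = m·Σ_{b<m} ‖C_b − T/m‖²`, `C_b = Σ_{ℓ≡b (m)} c_ℓ`, `T = Σ_ℓ c_ℓ` — the
additive variance with NO main term removed is the full centred class variance (corollary of Montgomery–Vaughan MNT I (4.4)
at a prime modulus; the refuter's `reducedVariance_prime_eq`). [cite: MontgomeryVaughan2007, §4.1 (4.4) p.109] -/
theorem reducedVariance_prime_eq {m : ℕ} (hp : m.Prime) (L : Finset ℕ) (c : ℕ → ℂ) :
    ∑ a ∈ range m with Nat.Coprime a m, ‖∑ l ∈ L, c l * eAdd m a l‖ ^ 2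
      = (m : ℝ) * ∑ b ∈ range m, ‖(∑ l ∈ L with l % m = b, c l) - (∑ l ∈ L, c l) / m‖ ^ 2 := by
  have h := reducedVariance_prime_mul_conj hp L c
  simp_rw [Complex.mul_conj'] at h
  exact_mod_cast h

/-- **The class-0 lower bound (F-ref1-ℓ1):** at a prime modulus the reduced-residue variance is at least
`m·‖C₀ − T/m‖²`, `C₀ = Σ_{m ∣ ℓ} c_ℓ` — the non-unit-frequency content, which no main term supported on the units of
`ℤ/m` removes (one term of the right side of `reducedVariance_prime_eq`; the refuter's `reducedVariance_prime_ge_classZero`).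
[cite: MontgomeryVaughan2007, §4.1 (4.4) p.109] -/
theorem reducedVariance_prime_ge_classZero {m : ℕ} (hp : m.Prime) (L : Finset ℕ) (c : ℕ → ℂ) :
    (m : ℝ) * ‖(∑ l ∈ L with l % m = 0, c l) - (∑ l ∈ L, c l) / m‖ ^ 2
      ≤ ∑ a ∈ range m with Nat.Coprime a m, ‖∑ l ∈ L, c l * eAdd m a l‖ ^ 2 := by
  rw [reducedVariance_prime_eq hp L c]
  refine mul_le_mul_of_nonneg_left ?_ (Nat.cast_nonneg m)
  have hmem : (0 : ℕ) ∈ range m := Finset.mem_range.mpr hp.pos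
  exact Finset.single_le_sum (f := fun b => ‖(∑ l ∈ L with l % m = b, c l) - (∑ l ∈ L, c l) / m‖ ^ 2)
    (fun b _ => by positivity) hmem

/-! ## Part B — bridge to the tree objects `lSumAdd` / `thinVarianceAdd` (p489286) -/

/-- The `a`-independent coefficient `c_ℓ = κ(dℓ)·θ_D(ℓ)·ℓ^{iτ}` of `lSumAdd` (body verbatim).
[cite: Zhang2022LandauSiegel, §14 (14.6)–(14.8) p.79] -/
def lCoef (κ : ℕ → ℂ) (d : ℕ) {D : ℕ} (θD : DirichletCharacter ℂ D) (τ : ℝ) (l : ℕ) : ℂ :=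
  κ (d * l) * θD (l : ZMod D) * ((l : ℂ) ^ ((τ : ℂ) * Complex.I))

/-- The `ℓ`-window `(⌊N⌋, ⌊2N⌋]` of `lSumAdd` (sharp dyadic window). [cite: Zhang2022LandauSiegel, §14 (14.6)–(14.8) p.79] -/
def lWindow (Nlen : ℝ) : Finset ℕ := Finset.Ioc ⌊Nlen⌋₊ ⌊2 * Nlen⌋₊

/-- `lSumAdd κ d θ_D τ N m a = Σ_{ℓ ∈ lWindow N} lCoef κ d θ_D τ ℓ · e(aℓ/m)` — by `rfl`.
[cite: Zhang2022LandauSiegel, §14 (14.6)–(14.8) p.79] -/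
theorem lSumAdd_eq_sum_lCoef_mul_eAdd (κ : ℕ → ℂ) (d : ℕ) {D : ℕ} (θD : DirichletCharacter ℂ D) (τ Nlen : ℝ)
    (m a : ℕ) : lSumAdd κ d θD τ Nlen m a = ∑ l ∈ lWindow Nlen, lCoef κ d θD τ l * eAdd m a l := rfl

/-- **The class-0 sum of the block** at one twist: `Σ_{m ∈ (M,2M], (m,D)=1, m prime} m·‖C₀(m) − T/m‖²` with
`T = Σ_{N<ℓ≤2N} c_ℓ`, `C₀(m) = Σ_{N<ℓ≤2N, m∣ℓ} c_ℓ`, `c_ℓ = lCoef κ d θ_D τ ℓ` — the left side of F-ref1-ℓ1's kernel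
half (a quantity, asserting nothing). [cite: Zhang2022LandauSiegel, §14 (14.6)–(14.8) p.79] -/
def classZeroAdd (κ : ℕ → ℂ) (d D : ℕ) (θD : DirichletCharacter ℂ D) (τ Nlen : ℝ) (M : ℕ) : ℝ :=
  ∑ m ∈ ((Finset.Ioc M (2 * M)).filter (fun m => Nat.Coprime m D)).filter Nat.Prime,
    (m : ℝ) * ‖(∑ l ∈ lWindow Nlen with l % m = 0, lCoef κ d θD τ l)
      - (∑ l ∈ lWindow Nlen, lCoef κ d θD τ l) / m‖ ^ 2

/-- The class-0 sum is non-negative. [cite: Zhang2022LandauSiegel, §14 (14.8) p.79] -/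
theorem classZeroAdd_nonneg (κ : ℕ → ℂ) (d D : ℕ) (θD : DirichletCharacter ℂ D) (τ Nlen : ℝ) (M : ℕ) :
    0 ≤ classZeroAdd κ d D θD τ Nlen M :=
  Finset.sum_nonneg fun m _ => by positivity

/-- **F-ref1-ℓ1, kernel half (ls-ref-1 g3's `classZero_le_thinVarianceAdd`):** the additive thin variance at a single
twist dominates the class-0 sum over the PRIME moduli of the block:
`classZeroAdd κ d D θ_D τ N M ≤ thinVarianceAdd κ d D {θ_D} τ N M` — prime by prime `reducedVariance_prime_ge_classZero`,
the composite moduli contributing non-negative terms. (The analytic half for Zhang's `κ* = κ₁∗b` is desk-level,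
VERDICTS §29; see `ClassZeroBeats`.) [cite: Zhang2022LandauSiegel, §14 (14.6)–(14.8) p.79] -/
theorem classZero_le_thinVarianceAdd (κ : ℕ → ℂ) (d D : ℕ) (θD : DirichletCharacter ℂ D) (τ Nlen : ℝ) (M : ℕ) :
    classZeroAdd κ d D θD τ Nlen M ≤ thinVarianceAdd κ d D {θD} τ Nlen M := by
  unfold thinVarianceAdd classZeroAdd
  rw [Finset.sum_singleton]
  calc ∑ m ∈ ((Finset.Ioc M (2 * M)).filter (fun m => Nat.Coprime m D)).filter Nat.Prime,
        (m : ℝ) * ‖(∑ l ∈ lWindow Nlen with l % m = 0, lCoef κ d θD τ l)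
          - (∑ l ∈ lWindow Nlen, lCoef κ d θD τ l) / m‖ ^ 2
      ≤ ∑ m ∈ ((Finset.Ioc M (2 * M)).filter (fun m => Nat.Coprime m D)).filter Nat.Prime,
          ∑ a ∈ range m with Nat.Coprime a m, ‖lSumAdd κ d θD τ Nlen m a‖ ^ 2 := by
        refine Finset.sum_le_sum fun m hm => ?_
        have hp : m.Prime := (Finset.mem_filter.mp hm).2
        simp_rw [lSumAdd_eq_sum_lCoef_mul_eAdd]
        exact reducedVariance_prime_ge_classZero hp (lWindow Nlen) (lCoef κ d θD τ)
    _ ≤ ∑ m ∈ (Finset.Ioc M (2 * M)).filter (fun m => Nat.Coprime m D),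
          ∑ a ∈ range m with Nat.Coprime a m, ‖lSumAdd κ d θD τ Nlen m a‖ ^ 2 :=
        Finset.sum_le_sum_of_subset_of_nonneg (Finset.filter_subset _ _)
          (fun m _ _ => Finset.sum_nonneg fun a _ => by positivity)

/-- The additive thin variance is monotone in the twist set (its summands are non-negative); in particular the
single-twist value bounds the value at any twist set containing `θ_D`. [cite: Zhang2022LandauSiegel, §14 (14.8) p.79] -/
theorem thinVarianceAdd_mono_twists (κ : ℕ → ℂ) (d D : ℕ) {tw tw' : Finset (DirichletCharacter ℂ D)} (h : tw ⊆ tw')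
    (τ Nlen : ℝ) (M : ℕ) : thinVarianceAdd κ d D tw τ Nlen M ≤ thinVarianceAdd κ d D tw' τ Nlen M := by
  unfold thinVarianceAdd
  exact Finset.sum_le_sum_of_subset_of_nonneg h
    (fun θ _ _ => Finset.sum_nonneg fun m _ => Finset.sum_nonneg fun a _ => by positivity)

/-! ## Part C — the refutation schema: `¬ThinBDHAt` reduces to the ANALYTIC half (bookkeeping; asserts nothing) -/

/-- **`ClassZeroBeats A B c κ` — the ANALYTIC HALF of F-ref1-ℓ1 as a bare `Prop` (OPEN in the kernel; asserted by no one;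
ls-ref-1 g3's desk analysis, VERDICTS §29 (i)–(iii), claims it for Zhang's `κ* = κ₁∗b` at the principal twist, `d = 1`,
`τ = 0`, with a violation by a power of `D` for every `B < ½`, `c > 0`).** At the free scales `P = D^A`, `T = D^B`: for
every allowance `(C, C′, D₀)` there are `D ≥ D₀`, a twist `θ_D (mod D)`, `1 ≤ d ≤ 2P₄`, `|τ| ≤ (log D)^600` and a modulus
range `M ∈ [M₀, 2P₄]` (the binders of `ThinBDHAt`, verbatim) at which the class-0 sum EXCEEDS the `ThinBDHAt` right side
`C·N²·(M₀/M)·(log D)^{C′}`, `N = D·M·P·t₀`. [cite: Zhang2022LandauSiegel, §14 (14.6)–(14.8) p.79; §15 (15.1)–(15.2)] -/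
def ClassZeroBeats (A B c : ℝ) (κ : ℕ → ℕ → ℂ) : Prop :=
  ∀ C C' : ℝ, ∀ D₀ : ℕ, ∃ D : ℕ, D₀ ≤ D ∧
    ∃ θD : DirichletCharacter ℂ D,
    ∃ d : ℕ, 1 ≤ d ∧ (d : ℝ) ≤ 2 * (scalesAt A B D).P4 ∧
    ∃ τ : ℝ, |τ| ≤ Real.log D ^ (600 : ℕ) ∧
    ∃ M : ℕ, M0 (scalesAt A B D) D c ≤ M ∧ (M : ℝ) ≤ 2 * (scalesAt A B D).P4 ∧
      C * ((D : ℝ) * M * (scalesAt A B D).P * (scalesAt A B D).t0) ^ 2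
            * (M0 (scalesAt A B D) D c / M) * Real.log D ^ C'
        < classZeroAdd (κ D) d D θD τ ((D : ℝ) * M * (scalesAt A B D).P * (scalesAt A B D).t0) M

/-- **Refutation schema (F-ref1-ℓ1):** the analytic half refutes the additive hypothesis — `ClassZeroBeats A B c κ →
¬ ThinBDHAt A B c κ` (instantiate `ThinBDHAt` at the singleton twist set `{θ_D}` and compare with
`classZero_le_thinVarianceAdd`). Bookkeeping: asserts nothing about any particular `κ`.
[cite: Zhang2022LandauSiegel, §14 (14.6)–(14.8) p.79] -/
theorem not_thinBDHAt_of_classZeroBeats {A B c : ℝ} {κ : ℕ → ℕ → ℂ} (h : ClassZeroBeats A B c κ) :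
    ¬ ThinBDHAt A B c κ := by
  rintro ⟨C, C', D₀, hall⟩
  obtain ⟨D, hD, θD, d, hd1, hd2, τ, hτ, M, hM1, hM2, hlt⟩ := h C C' D₀
  have hle := hall D hD {θD} d hd1 hd2 τ hτ M hM1 hM2
  have hcz := classZero_le_thinVarianceAdd (κ D) d D θD τ
    ((D : ℝ) * M * (scalesAt A B D).P * (scalesAt A B D).t0) M
  exact absurd (lt_of_lt_of_le hlt (hcz.trans hle)) (lt_irrefl _)

/-- If the analytic half holds at EVERY saving `c > 0`, the card's First lemma `ThinBDH A B κ` (`∃ c > 0, ThinBDHAt A B c κ`)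
fails for that family. Bookkeeping. [cite: Zhang2022LandauSiegel, §14 (14.6)–(14.8) p.79] -/
theorem not_thinBDH_of_classZeroBeats {A B : ℝ} {κ : ℕ → ℕ → ℂ} (h : ∀ c : ℝ, 0 < c → ClassZeroBeats A B c κ) :
    ¬ ThinBDH A B κ := by
  rintro ⟨c, hc, hX⟩
  exact not_thinBDHAt_of_classZeroBeats (h c hc) hX

/-- The schema at Zhang's family `D ↦ κ₁∗b_D` (p493151 `ThinBDHZhangAt A B c c′ b := ThinBDHAt A B c (D ↦ kappaStarAt c′
(scalesAt A B D) (b D))`): the analytic half at that family refutes `ThinBDHZhangAt`. Bookkeeping; the analytic half itself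
is NOT proved here. [cite: Zhang2022LandauSiegel, §14 (14.8) p.79; §15 p.81] -/
theorem not_thinBDHZhangAt_of_classZeroBeats {A B c c' : ℝ} {b : ℕ → ℕ → ℂ}
    (h : ClassZeroBeats A B c fun D => kappaStarAt c' (scalesAt A B D) (b D)) : ¬ ThinBDHZhangAt A B c c' b :=
  not_thinBDHAt_of_classZeroBeats h

/-- … and at every saving: `(∀ c > 0, ClassZeroBeats A B c (κ₁∗b)) → ¬ ThinBDHZhang A B c′ b`. Bookkeeping.
[cite: Zhang2022LandauSiegel, §14 (14.8) p.79; §15 p.81] -/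
theorem not_thinBDHZhang_of_classZeroBeats {A B c' : ℝ} {b : ℕ → ℕ → ℂ}
    (h : ∀ c : ℝ, 0 < c → ClassZeroBeats A B c fun D => kappaStarAt c' (scalesAt A B D) (b D)) :
    ¬ ThinBDHZhang A B c' b :=
  not_thinBDH_of_classZeroBeats h

end KnifeEdgeEll.PrimeDischarge

end Literature.NumberTheory.LFunctions.Zhang2022
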